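import Literature.MathematicalPhysics.QuantumFieldTheory.Balaban1983to89.B9Eq3153FrakGLipschitz
import Literature.MathematicalPhysics.QuantumFieldTheory.Balaban1983to89.B11Eq117TransformationNorm

/-!
# `Balaban1983to89.B11Eq117LetterDefects` — T. Bałaban, *The variational problem and background fields in renormalization group method for
# lattice gauge theories*, Commun. Math. Phys. **102** (1985) 277–309 [Balaban1985Variational] (115)/(117) p. 294–295 with [Balaban1985BackgroundPropagators]
# Thm 3.4 p. 400, (3.126) p. 420, (3.153) p. 426: THE CHART'S LETTERS `𝔊(U)`, `H₁(U)` READ ACROSS THE TWO (115) NORMS — the identity of configurations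
# between `Space115 … (∇_U)` and `Space115 … (∇_1)` is bounded by `1 + w̄₁·2|η|⁻¹ε·w̲₀⁻¹`, and through it `‖𝔊(U)f − 𝔊(1)f‖_(115),∇_1 ≤ K_G·ε·|f|_(−3)`,
# `‖H₁(U)B − H₁(1)B‖_(115),∇_1 ≤ K_A·ε·|B|_(−0)` at every small field of a fixed lattice (the intertwining defects `δ_G`, `δ_A`, `K_ι` consumed by
# `B11Eq120SolutionContinuity`)

statement-level skeleton of published theorems with citation tags; proofs where landed; nothing here is a claim about the Yang–Mills mass gap

PDF held: `paper:balaban1985-cmp102-variational-background` (journal page = PDF page + 276), p. 294 (115), p. 295 (117) *«the norm max{|·|_(−1), |∇·|_(−2)}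
of the transformation»*; `paper:balaban1985-cmp99-background-propagators` p. 400 Thm 3.4 (*«analytic functions of A»*, *«in the operator norm»*) — read in
the cell at a fixed lattice as Lipschitz continuity of the letters in `U` at the flat point (`B9Eq386LipschitzH1`, `B9Eq3153FrakGLipschitz`, `L²` level);
this file carries it to the type of (115), whose norm depends on `U` through `∇_U` ([Balaban1985BackgroundPropagators] (3.3)).

WHY THIS FILE (cell context).  `B11Eq120SolutionContinuity` (gen 82) compares the solutions of (116) on two carriers through a bounded linear `ι` given
the defects `‖ι(𝒢₁f) − 𝒢₂f‖ ≤ δ_G‖f‖`, `‖ι𝔄₁ − 𝔄₂‖ ≤ δ_A`, `‖ι‖ ≤ K_ι`.  For the NE9 chain's chart of `cur U` against the flat chart the carriers are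
`Space115 … (nabla115 η U)` and `Space115 … (nabla115 η 1)`, `ι` = the identity of the underlying configurations, `𝒢₁ = 𝔊(U)`, `𝒢₂ = 𝔊(1)`
(`frakGLatticeCLM`), `𝔄₁ = H₁(U)B`, `𝔄₂ = H₁(1)B` (`H1LatticeCLM`).  This file PRODUCES `K_ι`, `δ_G`, `δ_A` at every small field of a fixed lattice.

WHAT IS PROVED (sorry-free; [folklore] finite-lattice bookkeeping; 0 def — the comparison map is the explicit term
`LinearMap.toContinuousLinearMap ((jetLinearEquiv … D′).symm.toLinearMap ∘ₗ (jetLinearEquiv … D).toLinearMap)`; no inequality of the paper asserted).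
* §1 `jetId_apply` (underlying function unchanged), **`norm_jetId_le`** (`‖ι_{D→D′} f‖ ≤ (1 + w̄₁·δ·w̲₀⁻¹)‖f‖` from `‖(D′ − D)g‖_∞ ≤ δ‖g‖_∞`),
  `jetId_toCLM115` / `jetId_blockCLM115` (`ι ∘ toCLM115 D T = toCLM115 D′ T`, the same for block letters — `rfl`).
* §2 **`norm_nabla115_sub_flat_le`**: `‖∇_1 A − ∇_U A‖_∞ ≤ 2|η|⁻¹·ε·‖A‖_∞` for `U(b) ∈ U1`, `‖U(b) − 1‖ ≤ ε` ([B9] (3.3); conjugation by a near-identity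
  unit-bounded variable, ne9-leaf-03's `B9Eq319QprimeLipschitz.norm_conj_sub_le_of_mem_U1`).
* §3 **`norm_toCLM115_readFun_sub_le`** / **`norm_blockCLM115_readFun_sub_le`**: an `L²` operator DIFFERENCE `‖T₁x − T₂x‖ ≤ δ‖x‖` read in the type
  `|·|_(−3) → (115)` resp. `|·|_(−0) → (115)` is bounded by `max(w̄₀, w̄₁M_∇)·(M_φδ√(c·#)M_φ′∕√c₀)·w̲⁻¹` (`B11Eq117TransformationNorm`).
* §4 **`exists_letter_defects_at_flat`** — AT THE CHAIN'S LETTERS: `∃ K_G K_A ε₉ > 0 ∀ U` (E162 data, `‖U(b) − 1‖ ≤ ε ≤ ε₉`, `hRS`) `∀ hpos hQ hpos₁ hQ₁`,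
  `‖ι(𝔊(U)f) − 𝔊(1)f‖ ≤ K_G·ε·‖f‖` and `‖ι(H₁(U)B) − H₁(1)B‖ ≤ K_A·ε·‖B‖` in `Space115 … (∇_1)`, with `ι` the jet identity `∇_U → ∇_1`
  (from `B9Eq3153FrakGLipschitz.exists_lipschitz_frakG_at_flat`, `B9Eq386LipschitzH1.exists_lipschitz_G1_H1_at_flat`, §1–§3); and
  **`norm_jetId_nabla_le`**: `‖ι f‖ ≤ (1 + w̄₁·2|η|⁻¹ε·w̲₀⁻¹)‖f‖` at such `U`.
MODEL / HONEST SCOPE.  Finite index sets, finite-dimensional fibre; every constant is a finite-lattice number (extreme weights, `#bonds`, `c₀`, `c₁`,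
`M_φ`, `M_φ′`, the constants of (Q2)/(Q3)) — NOT print's lattice-uniform statement, NOT analyticity in `A`, first order AT THE FLAT POINT only; NOT
summit progress (cell pub-balaban: NE9 NOT PRINTED / NOT PROVED; spine PROVED 0/9).  Filed by the pub-balaban NE9 BINDER-row owner lineage
`b2b-balaban-t4-ne9-p1` (gen 82); NEW file importing `B9Eq3153FrakGLipschitz`, `B11Eq117TransformationNorm` only; nothing modified.  Net new unproved facts: 0.
-/

noncomputable section

namespace Literature.MathematicalPhysics.QuantumFieldTheory.Balaban1983to89.B11Eq117LetterDefects

open scoped InnerProductSpace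
open Metric Set
open B11Eq115Space B11Eq111FrakG B11Eq103H1Complex
open B11Eq117TransformationNorm (norm_toCLM115_apply_le norm_blockCLM115_apply_le norm_readFun_apply_le norm_nabla115_le frakGLin_fun_eq_readFun)
open B9Eq311L2Pairing (WL2)
open B9SectCLatticeCarrier (Bond)
open B4Sect5Torus (TSite)
open B7Prop1Explicit (U1 Wcx boxVec)
open B9Eq319QprimeTorus (fineP)
open B9Eq310HessianOperator (adTransportW hessOp)
open B9Eq315QTorus (perCfg cornerSite QtorusW laplaceAofBackground)
open B9Eq315QTorusOnto (liftSite perSite_liftSite)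
open B5Eq172FlatCoercivity (hU1_one hreg_one)
open B9Eq386LipschitzH1 (exists_lipschitz_G1_H1_at_flat)
open B9Eq3153FrakGLipschitz (exists_lipschitz_frakG_at_flat)
open B9Eq319QprimeLipschitz (norm_conj_sub_le_of_mem_U1)

/-! ## §1 The identity of configurations between the (115) norms at two derivative letters -/

section Jet

variable {ι κ : Type*} [Fintype ι] [Fintype κ] {V : Type*} [NormedAddCommGroup V] [NormedSpace ℂ V] [FiniteDimensional ℂ V]
  {L η : ℝ} [Fact (0 < L)] [Fact (0 < η)] {lev₀ : ι → ℕ} (lev₁ : κ → ℕ) (D D' : (ι → V) →ₗ[ℂ] (κ → V))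

/-- **The comparison map `ι_{D→D′}`** — the identity of the underlying configurations read from `Space115 … D` to `Space115 … D′` (written as the
explicit term `toContinuousLinearMap ((jetLinearEquiv D′)⁻¹ ∘ jetLinearEquiv D)`) — does not change the function.
[cite: Balaban1985Variational, (115) p.294] -/
theorem jetId_apply (f : Space115 L η lev₀ lev₁ D) :
    JetSup.equiv _ _ D' (LinearMap.toContinuousLinearMap
      ((jetLinearEquiv L η lev₀ lev₁ D').symm.toLinearMap ∘ₗ (jetLinearEquiv L η lev₀ lev₁ D).toLinearMap) f) = JetSup.equiv _ _ D f :=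
  rfl

/-- **`‖ι_{D→D′} f‖ ≤ (1 + w̄₁·δ·w̲₀⁻¹)·‖f‖`**: the (115) norm `max{|A|_(−1), |D′A|_(−2)}` against `max{|A|_(−1), |DA|_(−2)}` when `‖D′g − Dg‖_∞ ≤ δ‖g‖_∞`
(`|D′A|_(−2) ≤ |DA|_(−2) + w̄₁‖(D′ − D)A‖_∞ ≤ |DA|_(−2) + w̄₁δw̲₀⁻¹|A|_(−1)`; `w̄₁`, `w̲₀⁻¹` the extreme weights).
[cite: Balaban1985Variational, (115) p.294, (117) p.295] -/
theorem norm_jetId_le {δ : ℝ} (hδ : 0 ≤ δ) (hD : ∀ g, ‖D' g - D g‖ ≤ δ * ‖g‖) (f : Space115 L η lev₀ lev₁ D) :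
    ‖LinearMap.toContinuousLinearMap
        ((jetLinearEquiv L η lev₀ lev₁ D').symm.toLinearMap ∘ₗ (jetLinearEquiv L η lev₀ lev₁ D).toLinearMap) f‖ ≤
      (1 + (NegSup.wSup (levWeight L η lev₁ 2) : ℝ) * δ * NegSup.wInvSup (levWeight L η lev₀ 1)) * ‖f‖ := by
  set F := LinearMap.toContinuousLinearMap
        ((jetLinearEquiv L η lev₀ lev₁ D').symm.toLinearMap ∘ₗ (jetLinearEquiv L η lev₀ lev₁ D).toLinearMap) f with hF
  set g : ι → V := JetSup.equiv _ _ D f with hg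
  have hc : 0 ≤ (NegSup.wSup (levWeight L η lev₁ 2) : ℝ) * δ * NegSup.wInvSup (levWeight L η lev₀ 1) := by positivity
  have hfst : JetSup.fst F = JetSup.fst f := rfl
  have hsnd : JetSup.snd F = JetSup.snd f + (NegSup.equiv (levWeight L η lev₁ 2) V).symm (D' g - D g) := by
    show (D' g : κ → V) = D g + (D' g - D g)
    abel
  have h0 : ‖JetSup.fst F‖ ≤ (1 + (NegSup.wSup (levWeight L η lev₁ 2) : ℝ) * δ * NegSup.wInvSup (levWeight L η lev₀ 1)) * ‖f‖ := by
    rw [hfst]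
    refine (JetSup.norm_fst_le f).trans ?_
    have : ‖f‖ ≤ ‖f‖ + (NegSup.wSup (levWeight L η lev₁ 2) : ℝ) * δ * NegSup.wInvSup (levWeight L η lev₀ 1) * ‖f‖ :=
      le_add_of_nonneg_right (mul_nonneg hc (norm_nonneg f))
    linarith
  have h1 : ‖JetSup.snd F‖ ≤ (1 + (NegSup.wSup (levWeight L η lev₁ 2) : ℝ) * δ * NegSup.wInvSup (levWeight L η lev₀ 1)) * ‖f‖ := by
    rw [hsnd]
    refine (norm_add_le _ _).trans ?_
    have h2 : ‖(NegSup.equiv (levWeight L η lev₁ 2) V).symm (D' g - D g)‖ ≤ NegSup.wSup (levWeight L η lev₁ 2) * ‖D' g - D g‖ := by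
      have h := NegSup.norm_le_wSup_mul ((NegSup.equiv (levWeight L η lev₁ 2) V).symm (D' g - D g))
      rwa [Equiv.apply_symm_apply] at h
    have h3 : ‖g‖ ≤ NegSup.wInvSup (levWeight L η lev₀ 1) * ‖JetSup.fst f‖ := by
      have h := NegSup.sup_norm_le_wInvSup_mul (JetSup.fst f)
      rwa [JetSup.equiv_fst] at h
    have h4 : ‖D' g - D g‖ ≤ δ * (NegSup.wInvSup (levWeight L η lev₀ 1) * ‖f‖) :=
      (hD g).trans (mul_le_mul_of_nonneg_left (h3.trans (mul_le_mul_of_nonneg_left (JetSup.norm_fst_le f)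
        (NegSup.wInvSup (levWeight L η lev₀ 1)).coe_nonneg)) hδ)
    have h5 : ‖(NegSup.equiv (levWeight L η lev₁ 2) V).symm (D' g - D g)‖ ≤
        (NegSup.wSup (levWeight L η lev₁ 2) : ℝ) * δ * NegSup.wInvSup (levWeight L η lev₀ 1) * ‖f‖ := by
      refine h2.trans ?_
      have := mul_le_mul_of_nonneg_left h4 (NegSup.wSup (levWeight L η lev₁ 2)).coe_nonneg
      refine this.trans (le_of_eq ?_); ring
    have h6 := JetSup.norm_snd_le f
    linarith
  exact (JetSup.norm_le_iff (𝕜 := ℂ) (w₀ := levWeight L η lev₀ 1) (w₁ := levWeight L η lev₁ 2) (D := D')).2 ⟨h0, h1⟩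

/-- `ι ∘ toCLM115 D T = toCLM115 D′ T` (the same transformation of functions read in the other (115) norm). [cite: Balaban1985Variational, (117) p.295] -/
theorem jetId_toCLM115 (T : (ι → V) →ₗ[ℂ] (ι → V)) (f : NegSize L η lev₀ 3 V) :
    LinearMap.toContinuousLinearMap
        ((jetLinearEquiv L η lev₀ lev₁ D').symm.toLinearMap ∘ₗ (jetLinearEquiv L η lev₀ lev₁ D).toLinearMap)
      (toCLM115 (L := L) (η := η) (lev₀ := lev₀) lev₁ D T f) = toCLM115 (L := L) (η := η) (lev₀ := lev₀) lev₁ D' T f :=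
  rfl

variable {β : Type*} [Fintype β] {levB : β → ℕ}

/-- `ι ∘ blockCLM115 D T = blockCLM115 D′ T`. [cite: Balaban1985Variational, (103) p.293, (117) p.295] -/
theorem jetId_blockCLM115 (T : (β → V) →ₗ[ℂ] (ι → V)) (B : NegSize L η levB 0 V) :
    LinearMap.toContinuousLinearMap
        ((jetLinearEquiv L η lev₀ lev₁ D').symm.toLinearMap ∘ₗ (jetLinearEquiv L η lev₀ lev₁ D).toLinearMap)
      (blockCLM115 (L := L) (η := η) (lev₀ := lev₀) lev₁ D T B) = blockCLM115 (L := L) (η := η) (lev₀ := lev₀) lev₁ D' T B :=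
  rfl

end Jet

/-! ## §2 The derivative letters of (115) at `U` and at `1`: `‖∇_1 A − ∇_U A‖_∞ ≤ 2|η|⁻¹·ε·‖A‖_∞` -/

section Nabla

variable {d : ℕ} {Pd : Fin d → ℕ} {𝔸 : Type*} [NormedRing 𝔸] [NormedAlgebra ℂ 𝔸] [NormOneClass 𝔸]

/-- **`‖∇_1 A − ∇_U A‖_∞ ≤ 2|η|⁻¹·ε·‖A‖_∞`** for a unit-bounded background `ε`-close to `1`: pointwise `(∇_U A − ∇_1 A)(b, ν) = η⁻¹(U A(b₊) U⁻¹ − A(b₊))`,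
a conjugation by a near-identity variable ([B9] (3.3); `B9Eq319QprimeLipschitz.norm_conj_sub_le_of_mem_U1`).
[cite: Balaban1985BackgroundPropagators, (3.3) p.391; Balaban1985Variational, (115) p.294] -/
theorem norm_nabla115_sub_flat_le (η : ℝ) (U : Bond d Pd → 𝔸ˣ) (hU1 : ∀ b, U b ∈ U1 𝔸) {ε : ℝ} (hε : 0 ≤ ε)
    (hUε : ∀ b, ‖(U b : 𝔸) - 1‖ ≤ ε) (A : Bond d Pd → 𝔸) :
    ‖nabla115 η (fun _ : Bond d Pd => (1 : 𝔸ˣ)) A - nabla115 η U A‖ ≤ 2 * ‖((η : ℂ))⁻¹‖ * ε * ‖A‖ := by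
  refine (pi_norm_le_iff_of_nonneg (by positivity)).2 fun bν => ?_
  obtain ⟨b, ν⟩ := bν
  rw [Pi.sub_apply, nabla115_apply, nabla115_apply, Units.val_one, inv_one, Units.val_one, one_mul, mul_one, ← smul_sub,
    sub_sub_sub_cancel_right, norm_smul]
  have h1 : ‖A (B9SectCLatticeCarrier.btgt b, ν) - (U b : 𝔸) * A (B9SectCLatticeCarrier.btgt b, ν) * (((U b)⁻¹ : 𝔸ˣ) : 𝔸)‖ ≤
      2 * ε * ‖A (B9SectCLatticeCarrier.btgt b, ν)‖ := by
    rw [← norm_neg, neg_sub]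
    exact norm_conj_sub_le_of_mem_U1 (hU1 b) (hUε b) _
  have h2 : ‖A (B9SectCLatticeCarrier.btgt b, ν)‖ ≤ ‖A‖ := norm_le_pi_norm A _
  calc ‖((η : ℂ))⁻¹‖ * ‖A (B9SectCLatticeCarrier.btgt b, ν) - (U b : 𝔸) * A (B9SectCLatticeCarrier.btgt b, ν) * (((U b)⁻¹ : 𝔸ˣ) : 𝔸)‖
      ≤ ‖((η : ℂ))⁻¹‖ * (2 * ε * ‖A‖) :=
        mul_le_mul_of_nonneg_left (h1.trans (mul_le_mul_of_nonneg_left h2 (by positivity))) (norm_nonneg _)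
    _ = 2 * ‖((η : ℂ))⁻¹‖ * ε * ‖A‖ := by ring

end Nabla

/-! ## §3 An `L²` operator DIFFERENCE read in the type of (115) -/

section Transfer

variable {ι β κ : Type*} [Fintype ι] [Fintype β] [Fintype κ] {V : Type*} [NormedAddCommGroup V] [NormedSpace ℂ V] [FiniteDimensional ℂ V]
  {L η : ℝ} [Fact (0 < L)] [Fact (0 < η)] {lev₀ : ι → ℕ} {levB : β → ℕ}
  {W : Type*} [NormedAddCommGroup W] [InnerProductSpace ℂ W] (φ : W ≃ₗ[ℂ] V) {c₀ c₁ : ℝ} [Fact (0 < c₀)] [Fact (0 < c₁)]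
  {Mφ Mφ' : ℝ} (hMφ : 0 ≤ Mφ) (hφ : ∀ w, ‖φ w‖ ≤ Mφ * ‖w‖) (hMφ' : 0 ≤ Mφ') (hφ' : ∀ X, ‖φ.symm X‖ ≤ Mφ' * ‖X‖)

omit [Fintype ι] [Fintype β] [FiniteDimensional ℂ V] [Fact (0 < L)] [Fact (0 < η)] [Fact (0 < c₀)] in
/-- `readFun` is additive in the operator: `readFun φ (T₁ − T₂) = readFun φ T₁ − readFun φ T₂` (conjugation by linear identifications).
[cite: Balaban1985Averaging, (18)–(19) p.21] -/
theorem readFun_sub {w : ι → ℝ} {w' : β → ℝ} (T₁ T₂ : WL2 ℂ w W →ₗ[ℂ] WL2 ℂ w' W) :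
    readFun φ w w' (T₁ - T₂) = readFun φ w w' T₁ - readFun φ w w' T₂ := by
  apply LinearMap.ext; intro g
  rw [LinearMap.sub_apply, readFun_apply, readFun_apply, readFun_apply, LinearMap.sub_apply, map_sub]

include hMφ hφ hMφ' hφ' in
/-- **AN `L²` DIFFERENCE `‖T₁x − T₂x‖ ≤ δ‖x‖` READ IN THE TYPE `|·|_(−3) → (115)`**: `‖toCLM115 D (read T₁) f − toCLM115 D (read T₂) f‖ ≤
max(w̄₀, w̄₁M_∇)·(M_φδ√(c₀#ι)M_φ′∕√c₀)·w̲₃⁻¹·‖f‖` (`B11Eq117TransformationNorm.norm_toCLM115_apply_le` on `T₁ − T₂`).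
[cite: Balaban1985Variational, (117) p.295; Balaban1985BackgroundPropagators, Thm 3.4 p.400] -/
theorem norm_toCLM115_readFun_sub_le (lev₁ : κ → ℕ) (Dc : (ι → V) →ₗ[ℂ] (κ → V)) (T₁ T₂ : WL2 ℂ (fun _ : ι => c₀) W →ₗ[ℂ] WL2 ℂ (fun _ : ι => c₀) W)
    {δ MD : ℝ} (hδ : 0 ≤ δ) (hT : ∀ x, ‖T₁ x - T₂ x‖ ≤ δ * ‖x‖) (hD : ∀ g, ‖Dc g‖ ≤ MD * ‖g‖) (f : NegSize L η lev₀ 3 V) :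
    ‖toCLM115 (L := L) (η := η) (lev₀ := lev₀) lev₁ Dc (readFun φ (fun _ : ι => c₀) (fun _ : ι => c₀) T₁) f -
        toCLM115 (L := L) (η := η) (lev₀ := lev₀) lev₁ Dc (readFun φ (fun _ : ι => c₀) (fun _ : ι => c₀) T₂) f‖ ≤
      max (NegSup.wSup (levWeight L η lev₀ 1) : ℝ) (NegSup.wSup (levWeight L η lev₁ 2) * MD) *
        (Mφ * δ * (Real.sqrt (c₀ * Fintype.card ι) * Mφ') / Real.sqrt c₀) * NegSup.wInvSup (levWeight L η lev₀ 3) * ‖f‖ := by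
  have e : toCLM115 (L := L) (η := η) (lev₀ := lev₀) lev₁ Dc (readFun φ (fun _ : ι => c₀) (fun _ : ι => c₀) T₁) f -
        toCLM115 (L := L) (η := η) (lev₀ := lev₀) lev₁ Dc (readFun φ (fun _ : ι => c₀) (fun _ : ι => c₀) T₂) f =
      toCLM115 (L := L) (η := η) (lev₀ := lev₀) lev₁ Dc (readFun φ (fun _ : ι => c₀) (fun _ : ι => c₀) (T₁ - T₂)) f := by
    apply (JetSup.equiv _ _ Dc).injective
    rw [JetSup.equiv_sub, toCLM115_apply, toCLM115_apply, toCLM115_apply, readFun_sub, LinearMap.sub_apply]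
  rw [e]
  exact norm_toCLM115_apply_le lev₁ Dc _ (by positivity)
    (norm_readFun_apply_le φ hMφ hφ hMφ' hφ' (T₁ - T₂) hδ (fun x => by rw [LinearMap.sub_apply]; exact hT x)) hD f

include hMφ hφ hMφ' hφ' in
/-- **AN `L²` DIFFERENCE READ IN THE TYPE `|·|_(−0) → (115)`** (block letters, e.g. `H₁(U) − H₁(1)`): `‖H1CLM D T₁ B − H1CLM D T₂ B‖ ≤
max(w̄₀, w̄₁M_∇)·(M_φδ√(c₁#β)M_φ′∕√c₀)·w̲₀⁻¹·‖B‖`. [cite: Balaban1985Variational, (103) p.293, (117) p.295; Balaban1985BackgroundPropagators, Thm 3.4 p.400] -/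
theorem norm_H1CLM_sub_le (lev₁ : κ → ℕ) (Dc : (ι → V) →ₗ[ℂ] (κ → V)) (T₁ T₂ : WL2 ℂ (fun _ : β => c₁) W →ₗ[ℂ] WL2 ℂ (fun _ : ι => c₀) W)
    {δ MD : ℝ} (hδ : 0 ≤ δ) (hT : ∀ x, ‖T₁ x - T₂ x‖ ≤ δ * ‖x‖) (hD : ∀ g, ‖Dc g‖ ≤ MD * ‖g‖) (B : NegSize L η levB 0 V) :
    ‖H1CLM (L := L) (η := η) (lev₀ := lev₀) (levB := levB) φ lev₁ Dc T₁ B - H1CLM (L := L) (η := η) (lev₀ := lev₀) (levB := levB) φ lev₁ Dc T₂ B‖ ≤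
      max (NegSup.wSup (levWeight L η lev₀ 1) : ℝ) (NegSup.wSup (levWeight L η lev₁ 2) * MD) *
        (Mφ * δ * (Real.sqrt (c₁ * Fintype.card β) * Mφ') / Real.sqrt c₀) * NegSup.wInvSup (levWeight L η levB 0) * ‖B‖ := by
  have e : H1CLM (L := L) (η := η) (lev₀ := lev₀) (levB := levB) φ lev₁ Dc T₁ B - H1CLM (L := L) (η := η) (lev₀ := lev₀) (levB := levB) φ lev₁ Dc T₂ B =
      blockCLM115 (L := L) (η := η) (lev₀ := lev₀) lev₁ Dc (readFun φ (fun _ : β => c₁) (fun _ : ι => c₀) (T₁ - T₂)) B := by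
    unfold H1CLM
    apply (JetSup.equiv _ _ Dc).injective
    rw [JetSup.equiv_sub, blockCLM115_apply, blockCLM115_apply, blockCLM115_apply, readFun_sub, LinearMap.sub_apply]
  rw [e]
  exact norm_blockCLM115_apply_le lev₁ Dc _ (by positivity)
    (norm_readFun_apply_le φ hMφ hφ hMφ' hφ' (T₁ - T₂) hδ (fun x => by rw [LinearMap.sub_apply]; exact hT x)) hD B

variable [FiniteDimensional ℂ W] {S : Type*} [AddCommGroup S] [Module ℂ S]

omit [Fact (0 < c₁)] in
/-- **`ι ∘ 𝔊 = toCLM115 D′ (read 𝔊ᴴ)`**: the (115)-letter `frakG lev₁ D (G1Fun φ G₁) (QFun φ Q) (QadjFun φ Q) K⁻¹ (DFun φ D) R (DstarFun φ D*)` read through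
the jet identity `ι_{D→D′}` IS the Hilbert-level `𝔊 = frakGLin G₁ Q Q† K⁻¹ D R D*` read on the functions in the type at `D′`
(`B11Eq117TransformationNorm.frakGLin_fun_eq_readFun` + §1). [cite: Balaban1985Variational, (110)–(111) p.294, (117) p.295] -/
theorem jetId_frakG_eq_toCLM115_readFun {wB : β → ℝ} [Fact (∀ y, 0 < wB y)] (lev₁ : κ → ℕ) (D D' : (ι → V) →ₗ[ℂ] (κ → V))
    (G₁ : WL2 ℂ (fun _ : ι => c₀) W →ₗ[ℂ] WL2 ℂ (fun _ : ι => c₀) W) (Q : WL2 ℂ (fun _ : ι => c₀) W →ₗ[ℂ] WL2 ℂ wB W)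
    (Kinv : WL2 ℂ wB W →ₗ[ℂ] WL2 ℂ wB W) (Dm : S →ₗ[ℂ] WL2 ℂ (fun _ : ι => c₀) W) (Rr : S →ₗ[ℂ] S) (Dstar : WL2 ℂ (fun _ : ι => c₀) W →ₗ[ℂ] S)
    (f : NegSize L η lev₀ 3 V) :
    LinearMap.toContinuousLinearMap ((jetLinearEquiv L η lev₀ lev₁ D').symm.toLinearMap ∘ₗ (jetLinearEquiv L η lev₀ lev₁ D).toLinearMap)
        (frakG (L := L) (η := η) (lev₀ := lev₀) lev₁ D (G1Fun φ G₁) (QFun φ Q) (QadjFun φ Q) Kinv (DFun φ Dm) Rr (DstarFun φ Dstar) f) =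
      toCLM115 (L := L) (η := η) (lev₀ := lev₀) lev₁ D'
        (readFun φ (fun _ : ι => c₀) (fun _ : ι => c₀) (frakGLin G₁ Q (LinearMap.adjoint Q) Kinv Dm Rr Dstar)) f := by
  unfold frakG
  rw [frakGLin_fun_eq_readFun]
  rfl

omit [Fact (0 < c₁)] in
/-- **`𝔊 = toCLM115 D (read 𝔊ᴴ)`** (no change of norm): the same identification at one derivative letter. [cite: Balaban1985Variational, (110)–(111) p.294] -/
theorem frakG_eq_toCLM115_readFun {wB : β → ℝ} [Fact (∀ y, 0 < wB y)] (lev₁ : κ → ℕ) (D : (ι → V) →ₗ[ℂ] (κ → V))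
    (G₁ : WL2 ℂ (fun _ : ι => c₀) W →ₗ[ℂ] WL2 ℂ (fun _ : ι => c₀) W) (Q : WL2 ℂ (fun _ : ι => c₀) W →ₗ[ℂ] WL2 ℂ wB W)
    (Kinv : WL2 ℂ wB W →ₗ[ℂ] WL2 ℂ wB W) (Dm : S →ₗ[ℂ] WL2 ℂ (fun _ : ι => c₀) W) (Rr : S →ₗ[ℂ] S) (Dstar : WL2 ℂ (fun _ : ι => c₀) W →ₗ[ℂ] S)
    (f : NegSize L η lev₀ 3 V) :
    frakG (L := L) (η := η) (lev₀ := lev₀) lev₁ D (G1Fun φ G₁) (QFun φ Q) (QadjFun φ Q) Kinv (DFun φ Dm) Rr (DstarFun φ Dstar) f =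
      toCLM115 (L := L) (η := η) (lev₀ := lev₀) lev₁ D
        (readFun φ (fun _ : ι => c₀) (fun _ : ι => c₀) (frakGLin G₁ Q (LinearMap.adjoint Q) Kinv Dm Rr Dstar)) f := by
  unfold frakG
  rw [frakGLin_fun_eq_readFun]

end Transfer

/-! ## §4 At the chain's letters: the defects `K_ι`, `δ_G`, `δ_A` at every small field of a fixed lattice -/

section Letters

variable {d : ℕ} (L : ℕ) [NeZero L] (m : Fin d → ℕ) [∀ i, NeZero (fineP L m i)] (hL : 1 ≤ L)
  {𝔸 : Type*} [NormedRing 𝔸] [NormedAlgebra ℂ 𝔸] [CompleteSpace 𝔸] [NormOneClass 𝔸] [StarRing 𝔸] [NormedStarGroup 𝔸] [StarModule ℂ 𝔸]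
  [FiniteDimensional ℂ 𝔸]
  {W : Type*} [NormedAddCommGroup W] [InnerProductSpace ℂ W] [FiniteDimensional ℂ W] (φ : W ≃ₗ[ℂ] 𝔸) {c₀ c₁ : ℝ} [Fact (0 < c₀)] [Fact (0 < c₁)]

omit [NeZero L] [∀ i, NeZero (fineP L m i)] [CompleteSpace 𝔸] [StarRing 𝔸] [NormedStarGroup 𝔸] [StarModule ℂ 𝔸] in
/-- **`‖ι_{∇_U→∇_1} f‖ ≤ (1 + w̄₁·2|η|⁻¹ε·w̲₀⁻¹)·‖f‖`** — the jet identity from the (115) norm at the background `U` to the (115) norm at the flat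
background, for a unit-bounded field `ε`-close to `1` (§1 + §2). [cite: Balaban1985Variational, (115) p.294; Balaban1985BackgroundPropagators, (3.3) p.391] -/
theorem norm_jetId_nabla_le {η : ℝ} [Fact (0 < (L : ℝ))] [Fact (0 < η)] {lev₀ : Bond d (fineP L m) → ℕ} (lev₁ : Bond d (fineP L m) × Fin d → ℕ)
    (U : Bond d (fineP L m) → 𝔸ˣ) (hU1 : ∀ b, U b ∈ U1 𝔸) {ε : ℝ} (hε : 0 ≤ ε) (hUε : ∀ b, ‖(U b : 𝔸) - 1‖ ≤ ε)
    (f : Space115 (L : ℝ) η lev₀ lev₁ (nabla115 η U)) :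
    ‖LinearMap.toContinuousLinearMap
        ((jetLinearEquiv (L : ℝ) η lev₀ lev₁ (nabla115 η (fun _ : Bond d (fineP L m) => (1 : 𝔸ˣ)))).symm.toLinearMap ∘ₗ
          (jetLinearEquiv (L : ℝ) η lev₀ lev₁ (nabla115 η U)).toLinearMap) f‖ ≤
      (1 + (NegSup.wSup (levWeight (L : ℝ) η lev₁ 2) : ℝ) * (2 * ‖((η : ℂ))⁻¹‖ * ε) * NegSup.wInvSup (levWeight (L : ℝ) η lev₀ 1)) * ‖f‖ :=
  norm_jetId_le lev₁ (nabla115 η U) (nabla115 η fun _ => 1) (by positivity) (norm_nabla115_sub_flat_le η U hU1 hε hUε) f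

set_option maxHeartbeats 800000 in
set_option maxRecDepth 8192 in
/-- **THE LETTER DEFECTS AT THE FLAT POINT, AT A FIXED LATTICE** — for the chain's `𝔊(U) = frakGLatticeCLM …(∇_U)` and `H₁(U) = H1LatticeCLM …(∇_U)`
read in the flat (115) norm through the jet identity `ι = ι_{∇_U→∇_1}`: there are `K_G, K_A, ε₉ > 0` (finite-lattice numbers, for FIXED level maps) such
that for EVERY background `U` of E162's data with `‖U(b) − 1‖ ≤ ε ≤ ε₉` and `hRS`, and ANY `hpos, hQ` at `U`, `hpos₁, hQ₁` at `1`: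
`‖ι(𝔊(U)f) − 𝔊(1)f‖ ≤ K_G·ε·‖f‖` and `‖ι(H₁(U)B) − H₁(1)B‖ ≤ K_A·ε·‖B‖` — the `L²` Lipschitz letters of `B9Eq3153FrakGLipschitz` /
`B9Eq386LipschitzH1` ([B9] Thm 3.4 ∕ (3.86), first order at the flat point) read through `B11Eq117TransformationNorm` (§3) and `ι ∘ toCLM115(∇_U) =
toCLM115(∇_1)` (§1).  The inputs `δ_G`, `δ_A` of `B11Eq120SolutionContinuity.norm_map_solA_sub_solA_le` for the chart of `cur U` against the flat chart.
[cite: Balaban1985BackgroundPropagators, Thm 3.4 p.400, (3.86) p.407, (3.126) p.420, (3.153) p.426; Balaban1985Variational, (103) p.293, (111) p.294, (117) p.295] -/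
theorem exists_letter_defects_at_flat {η : ℝ} [Fact (0 < (L : ℝ))] [Fact (0 < η)] (lev₀ : Bond d (fineP L m) → ℕ) (levB : Bond d m → ℕ)
    (lev₁ : Bond d (fineP L m) × Fin d → ℕ) {a : ℝ} (ha : 0 < a) {Mφ Mφ' : ℝ} (hMφ : 0 ≤ Mφ) (hMφ' : 0 ≤ Mφ')
    (hφ : ∀ w, ‖φ w‖ ≤ Mφ * ‖w‖) (hφ' : ∀ X, ‖φ.symm X‖ ≤ Mφ' * ‖X‖) (τ : 𝔸 →ₗ[ℂ] ℂ) {Cτ : ℝ} (hτ : ∀ X, ‖τ X‖ ≤ Cτ * ‖X‖) (hCτ : 0 ≤ Cτ) :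
    ∃ KG KA ε₉ : ℝ, 0 < KG ∧ 0 < KA ∧ 0 < ε₉ ∧ ∀ (U : Bond d (fineP L m) → 𝔸ˣ) {α : ℝ} (hα1 : α ≤ 1 / 64)
      (hU1 : ∀ (x : B7Prop1Explicit.Site d) (κ : Fin d), perCfg (fineP L m) U x κ ∈ U1 𝔸)
      (hreg : ∀ (y : TSite d m) (κ : Fin d) (r : Fin d → Fin L), ‖((Wcx L (perCfg (fineP L m) U) (cornerSite L y) κ (boxVec L r) : 𝔸ˣ) : 𝔸) - 1‖ ≤ α)
      {ε : ℝ}, 0 ≤ ε → ε ≤ ε₉ → (∀ b, ‖(U b : 𝔸) - 1‖ ≤ ε) →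
      (∀ (b : Bond d (fineP L m)) (v u : W), ⟪adTransportW φ U b v, u⟫_ℂ = ⟪v, adTransportW φ (fun b => (U b)⁻¹) b u⟫_ℂ) →
      ∀ (hpos : ∀ x : BondL2K ℂ d (fineP L m) c₀ W, x ≠ 0 →
          0 < RCLike.re ⟪x, laplaceAofBackground L m hL φ U hα1 hU1 hreg τ η (c₀ := c₀) (c₁ := c₁) a x⟫_ℂ)
        (hQ : Function.Surjective (QtorusW L m hL φ U hα1 hU1 hreg (c₀ := c₀) (c₁ := c₁)))
        (hpos₁ : ∀ x : BondL2K ℂ d (fineP L m) c₀ W, x ≠ 0 →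
          0 < RCLike.re ⟪x, laplaceAofBackground L m hL φ (fun _ => 1) (show (0 : ℝ) ≤ 1 / 64 by norm_num) (hU1_one L m) (hreg_one L m) τ η
            (c₀ := c₀) (c₁ := c₁) a x⟫_ℂ)
        (hQ₁ : Function.Surjective (QtorusW L m hL φ (fun _ => 1) (show (0 : ℝ) ≤ 1 / 64 by norm_num) (hU1_one L m) (hreg_one L m)
          (c₀ := c₀) (c₁ := c₁))),
      (∀ f : NegSize (L : ℝ) η lev₀ 3 𝔸,
        ‖LinearMap.toContinuousLinearMap
            ((jetLinearEquiv (L : ℝ) η lev₀ lev₁ (nabla115 η (fun _ : Bond d (fineP L m) => (1 : 𝔸ˣ)))).symm.toLinearMap ∘ₗ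
              (jetLinearEquiv (L : ℝ) η lev₀ lev₁ (nabla115 η U)).toLinearMap)
            (frakGLatticeCLM (L := (L : ℝ)) (η := η) (lev₀ := lev₀) φ hpos hQ lev₁ (nabla115 η U) f) -
          frakGLatticeCLM (L := (L : ℝ)) (η := η) (lev₀ := lev₀) (Δ₁ := hessOp φ η (fun _ => 1) τ)
            (Q := QtorusW L m hL φ (fun _ => 1) (show (0 : ℝ) ≤ 1 / 64 by norm_num) (hU1_one L m) (hreg_one L m) (c₀ := c₀) (c₁ := c₁))
            φ hpos₁ hQ₁ lev₁ (nabla115 η fun _ => 1) f‖ ≤ KG * ε * ‖f‖) ∧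
      (∀ B : NegSize (L : ℝ) η levB 0 𝔸,
        ‖LinearMap.toContinuousLinearMap
            ((jetLinearEquiv (L : ℝ) η lev₀ lev₁ (nabla115 η (fun _ : Bond d (fineP L m) => (1 : 𝔸ˣ)))).symm.toLinearMap ∘ₗ
              (jetLinearEquiv (L : ℝ) η lev₀ lev₁ (nabla115 η U)).toLinearMap)
            (H1LatticeCLM (L := (L : ℝ)) (η := η) (lev₀ := lev₀) (levB := levB) φ hpos hQ lev₁ (nabla115 η U) B) -
          H1LatticeCLM (L := (L : ℝ)) (η := η) (lev₀ := lev₀) (levB := levB) (Δ₁ := hessOp φ η (fun _ => 1) τ)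
            (Q := QtorusW L m hL φ (fun _ => 1) (show (0 : ℝ) ≤ 1 / 64 by norm_num) (hU1_one L m) (hreg_one L m) (c₀ := c₀) (c₁ := c₁))
            φ hpos₁ hQ₁ lev₁ (nabla115 η fun _ => 1) B‖ ≤ KA * ε * ‖B‖) := by
  have hη : η ≠ 0 := ne_of_gt (Fact.out : 0 < η)
  obtain ⟨C₁, C₂, ε₇, hC₁, hC₂, hε₇, HGH⟩ := exists_lipschitz_G1_H1_at_flat L m hL φ (c₀ := c₀) (c₁ := c₁) hη ha hMφ hMφ' hφ hφ' τ hτ hCτ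
  obtain ⟨C₃, ε₈, hC₃, hε₈, HfG⟩ := exists_lipschitz_frakG_at_flat L m hL φ (c₀ := c₀) (c₁ := c₁) hη ha hMφ hMφ' hφ hφ' τ hτ hCτ
  obtain ⟨MD, hMDdef⟩ : ∃ MD : ℝ, MD = 2 * ‖((η : ℂ))⁻¹‖ := ⟨_, rfl⟩
  obtain ⟨K, hKdef⟩ : ∃ K : ℝ, K = max (NegSup.wSup (levWeight (L : ℝ) η lev₀ 1) : ℝ) (NegSup.wSup (levWeight (L : ℝ) η lev₁ 2) * MD) := ⟨_, rfl⟩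
  have hK : 0 ≤ K := by rw [hKdef]; exact le_max_of_le_left (NegSup.wSup (levWeight (L : ℝ) η lev₀ 1)).coe_nonneg
  have h1b : ∀ b : Bond d (fineP L m), ‖(((fun _ : Bond d (fineP L m) => (1 : 𝔸ˣ)) b : 𝔸ˣ) : 𝔸)‖ ≤ 1 ∧
      ‖((((fun _ : Bond d (fineP L m) => (1 : 𝔸ˣ)) b)⁻¹ : 𝔸ˣ) : 𝔸)‖ ≤ 1 := fun b =>
    ⟨by rw [Units.val_one, norm_one], by rw [inv_one, Units.val_one, norm_one]⟩
  have hD1 : ∀ g : Bond d (fineP L m) → 𝔸, ‖nabla115 η (fun _ : Bond d (fineP L m) => (1 : 𝔸ˣ)) g‖ ≤ MD * ‖g‖ := fun g => by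
    rw [hMDdef]
    exact norm_nabla115_le η _ h1b g
  refine ⟨K * (Mφ * C₃ * (Real.sqrt (c₀ * Fintype.card (Bond d (fineP L m))) * Mφ') / Real.sqrt c₀) * NegSup.wInvSup (levWeight (L : ℝ) η lev₀ 3) + 1,
    K * (Mφ * C₂ * (Real.sqrt (c₁ * Fintype.card (Bond d m)) * Mφ') / Real.sqrt c₀) * NegSup.wInvSup (levWeight (L : ℝ) η levB 0) + 1,
    min ε₇ ε₈, by positivity, by positivity, lt_min hε₇ hε₈, ?_⟩
  intro U α hα1 hU1 hreg ε hε hε₉ hUε hRS hpos hQ hpos₁ hQ₁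
  obtain ⟨-, hH⟩ := HGH U hα1 hU1 hreg hε (hε₉.trans (min_le_left _ _)) hUε hRS hpos hQ hpos₁ hQ₁
  have hG := HfG U hα1 hU1 hreg hε (hε₉.trans (min_le_right _ _)) hUε hRS hpos hQ hpos₁ hQ₁
  refine ⟨fun f => ?_, fun B => ?_⟩
  · have e1 : LinearMap.toContinuousLinearMap
            ((jetLinearEquiv (L : ℝ) η lev₀ lev₁ (nabla115 η (fun _ : Bond d (fineP L m) => (1 : 𝔸ˣ)))).symm.toLinearMap ∘ₗ
              (jetLinearEquiv (L : ℝ) η lev₀ lev₁ (nabla115 η U)).toLinearMap)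
            (frakGLatticeCLM (L := (L : ℝ)) (η := η) (lev₀ := lev₀) φ hpos hQ lev₁ (nabla115 η U) f) =
        toCLM115 (L := (L : ℝ)) (η := η) (lev₀ := lev₀) lev₁ (nabla115 η fun _ => 1)
          (readFun φ (fun _ => c₀) (fun _ => c₀) (frakGLatticeK hpos hQ)) f :=
      jetId_frakG_eq_toCLM115_readFun (L := (L : ℝ)) (η := η) (lev₀ := lev₀) φ lev₁ (nabla115 η U) (nabla115 η fun _ => 1)
        (G1LatticeK hpos) (QtorusW L m hL φ U hα1 hU1 hreg (c₀ := c₀) (c₁ := c₁)) (KinvLatticeK hpos hQ)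
        (covDerivL2K ℂ c₀ ((η : ℂ))⁻¹ (adTransportW φ U)) (B9Eq326OperatorAssembly.RofU L m φ η U)
        (covDivL2K ℂ c₀ ((η : ℂ))⁻¹ (adTransportW φ fun b => (U b)⁻¹)) f
    have e2 : frakGLatticeCLM (L := (L : ℝ)) (η := η) (lev₀ := lev₀) (Δ₁ := hessOp φ η (fun _ => 1) τ)
            (Q := QtorusW L m hL φ (fun _ => 1) (show (0 : ℝ) ≤ 1 / 64 by norm_num) (hU1_one L m) (hreg_one L m) (c₀ := c₀) (c₁ := c₁))
            φ hpos₁ hQ₁ lev₁ (nabla115 η fun _ => 1) f =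
        toCLM115 (L := (L : ℝ)) (η := η) (lev₀ := lev₀) lev₁ (nabla115 η fun _ => 1)
          (readFun φ (fun _ => c₀) (fun _ => c₀) (frakGLatticeK (Δ₁ := hessOp φ η (fun _ => 1) τ)
            (Q := QtorusW L m hL φ (fun _ => 1) (show (0 : ℝ) ≤ 1 / 64 by norm_num) (hU1_one L m) (hreg_one L m) (c₀ := c₀) (c₁ := c₁))
            hpos₁ hQ₁)) f :=
      frakG_eq_toCLM115_readFun (L := (L : ℝ)) (η := η) (lev₀ := lev₀) φ lev₁ (nabla115 η fun _ => 1)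
        (G1LatticeK hpos₁) (QtorusW L m hL φ (fun _ => 1) (show (0 : ℝ) ≤ 1 / 64 by norm_num) (hU1_one L m) (hreg_one L m) (c₀ := c₀) (c₁ := c₁))
        (KinvLatticeK hpos₁ hQ₁) (covDerivL2K ℂ c₀ ((η : ℂ))⁻¹ (adTransportW φ fun _ => 1)) (B9Eq326OperatorAssembly.RofU L m φ η fun _ => 1)
        (covDivL2K ℂ c₀ ((η : ℂ))⁻¹ (adTransportW φ fun b => ((fun _ : Bond d (fineP L m) => (1 : 𝔸ˣ)) b)⁻¹)) f
    rw [e1, e2]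
    have h := norm_toCLM115_readFun_sub_le (L := (L : ℝ)) (η := η) (lev₀ := lev₀) φ hMφ hφ hMφ' hφ' lev₁ (nabla115 η fun _ => 1)
      (frakGLatticeK hpos hQ) (frakGLatticeK (Δ₁ := hessOp φ η (fun _ => 1) τ)
        (Q := QtorusW L m hL φ (fun _ => 1) (show (0 : ℝ) ≤ 1 / 64 by norm_num) (hU1_one L m) (hreg_one L m) (c₀ := c₀) (c₁ := c₁)) hpos₁ hQ₁)
      (by positivity : 0 ≤ C₃ * ε) hG hD1 f
    rw [← hKdef] at h
    refine h.trans ?_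
    have hf := norm_nonneg f
    have h1 : K * (Mφ * (C₃ * ε) * (Real.sqrt (c₀ * Fintype.card (Bond d (fineP L m))) * Mφ') / Real.sqrt c₀) *
        NegSup.wInvSup (levWeight (L : ℝ) η lev₀ 3) * ‖f‖ =
      (K * (Mφ * C₃ * (Real.sqrt (c₀ * Fintype.card (Bond d (fineP L m))) * Mφ') / Real.sqrt c₀) * NegSup.wInvSup (levWeight (L : ℝ) η lev₀ 3)) *
        ε * ‖f‖ := by ring
    rw [h1]
    nlinarith [mul_nonneg hε hf]
  · have e1 : LinearMap.toContinuousLinearMap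
            ((jetLinearEquiv (L : ℝ) η lev₀ lev₁ (nabla115 η (fun _ : Bond d (fineP L m) => (1 : 𝔸ˣ)))).symm.toLinearMap ∘ₗ
              (jetLinearEquiv (L : ℝ) η lev₀ lev₁ (nabla115 η U)).toLinearMap)
            (H1LatticeCLM (L := (L : ℝ)) (η := η) (lev₀ := lev₀) (levB := levB) φ hpos hQ lev₁ (nabla115 η U) B) =
        H1CLM (L := (L : ℝ)) (η := η) (lev₀ := lev₀) (levB := levB) φ lev₁ (nabla115 η fun _ => 1) (H1LatticeK hpos hQ) B := rfl
    have e2 : H1LatticeCLM (L := (L : ℝ)) (η := η) (lev₀ := lev₀) (levB := levB) (Δ₁ := hessOp φ η (fun _ => 1) τ)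
            (Q := QtorusW L m hL φ (fun _ => 1) (show (0 : ℝ) ≤ 1 / 64 by norm_num) (hU1_one L m) (hreg_one L m) (c₀ := c₀) (c₁ := c₁))
            φ hpos₁ hQ₁ lev₁ (nabla115 η fun _ => 1) B =
        H1CLM (L := (L : ℝ)) (η := η) (lev₀ := lev₀) (levB := levB) φ lev₁ (nabla115 η fun _ => 1) (H1LatticeK (Δ₁ := hessOp φ η (fun _ => 1) τ)
          (Q := QtorusW L m hL φ (fun _ => 1) (show (0 : ℝ) ≤ 1 / 64 by norm_num) (hU1_one L m) (hreg_one L m) (c₀ := c₀) (c₁ := c₁)) hpos₁ hQ₁) B :=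
      rfl
    rw [e1, e2]
    have h := norm_H1CLM_sub_le (L := (L : ℝ)) (η := η) (lev₀ := lev₀) (levB := levB) φ hMφ hφ hMφ' hφ' lev₁ (nabla115 η fun _ => 1)
      (H1LatticeK hpos hQ) (H1LatticeK (Δ₁ := hessOp φ η (fun _ => 1) τ)
        (Q := QtorusW L m hL φ (fun _ => 1) (show (0 : ℝ) ≤ 1 / 64 by norm_num) (hU1_one L m) (hreg_one L m) (c₀ := c₀) (c₁ := c₁)) hpos₁ hQ₁)
      (by positivity : 0 ≤ C₂ * ε) hH hD1 B
    rw [← hKdef] at h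
    refine h.trans ?_
    have hB := norm_nonneg B
    have h1 : K * (Mφ * (C₂ * ε) * (Real.sqrt (c₁ * Fintype.card (Bond d m)) * Mφ') / Real.sqrt c₀) *
        NegSup.wInvSup (levWeight (L : ℝ) η levB 0) * ‖B‖ =
      (K * (Mφ * C₂ * (Real.sqrt (c₁ * Fintype.card (Bond d m)) * Mφ') / Real.sqrt c₀) * NegSup.wInvSup (levWeight (L : ℝ) η levB 0)) *
        ε * ‖B‖ := by ring
    rw [h1]
    nlinarith [mul_nonneg hε hB]

end Letters

end Literature.MathematicalPhysics.QuantumFieldTheory.Balaban1983to89.B11Eq117LetterDefects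

end
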